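import Summits.RiemannHypothesis.RiemannHypothesis.Theorems.Splittings.LiCriterionResidueClassesBLEngine
import HarnessLib

/-!
# Li's criterion along RESIDUE CLASSES `n ≡ t (mod q)` with a verified height as load-bearing input — part 3/3:
# the theorems for `ζ` (raw form over tree declarations; kernel instances from `riemannHypothesisUpTo_1000`: every class of
# every modulus `q ≤ 3141`, every shift `|t| ≤ 1570`)


**New kernel statement.**  Let `H ≥ 1` be a verified height (`RiemannHypothesisUpTo H`: every zero with
`0 < Im ρ ≤ H` is on the line), `q ≥ 1` a modulus and `t ∈ ℤ` a shift with `|t| < (π/2)(H − 1/4)`.  Then for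
every constant `C`

  `(∀ n ≥ 1, n ≡ t (mod q) → λ_n ≥ −C) → RH`   (`riemannHypothesis_of_keiperLiCoeff_bddBelow_modEq`),

hence `RH ↔ (λ_n)_{n ≡ t (q)}` bounded below `↔` nonneg `↔` any slack co-finite tail of the class.  With the tree's
KERNEL-checked `riemannHypothesisUpTo_1000` this is unconditional for all `|t| ≤ 1570`, i.e. for EVERY residue
class of EVERY modulus `q ≤ 3141` (`riemannHypothesis_iff_keiperLiCoeff_bddBelow_mod_of_le`).  g2 proved the
class `t = 0` (`LiCriterionProgressionsBL`, no height needed) and showed that NO class `t ≢ 0` can be decided at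
the level of Bombieri–Lagarias multisets (witness `1 − 1/ρ = ± i r`); the arithmetic input that rescues `ζ` is
exactly a zero-free height, entering LINEARLY: height `H` buys the shifts `|t| < (π/2)(H − 1/4)`.

PROOF (Bombieri–Lagarias' Theorem 1 (c)⇒(a) with a constrained recurrence).  In BL's proof the exponent `n` is
produced by simultaneous recurrence of the finitely many dominant `w_i/λ` (`|w_i| = λ` maximal); we run the
recurrence along multiples of `qL` (Bolzano–Weierstrass for `k ↦ (z_i^{kqL})_i`) with accuracy `ε`, and then
shift by `s = |t|`: `n = d·qL ± s ≡ t (mod q)`, `Re (z_i^n) ≥ Re(z_i^{±s}) − ε`.  So what is needed is a uniform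
PHASE CONDITION at exponent `s` on the off-line zeros: `Re(w^s) ≥ c₀ |w|^s`, `c₀ > 0`.  For `ζ`, an off-line zero
`ρ = β + iγ` has `|γ| > H` under `RiemannHypothesisUpTo H` (conjugation symmetry for `γ < 0`), and for
`z = 1 − 1/ρ`: `|arg z| ≤ |Im z|/Re z ≤ 1/(|γ| − 1/4)`, so `s·|arg z| ≤ s/(H − 1/4) =: Θ₀ < π/2` and
`Re(z^s) = |z|^s cos(s arg z) ≥ |z|^s cos Θ₀`.  SHARP at multiset level: a conjugate pair with
`arg(1 − 1/ρ) = ± π/(2s)` (so `s·θ = π/2`, `cos = 0`) has ALL its Li sums along `n ≡ s (mod 4s)` equal to `2`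
(`LiResidueBL.sharp_pair_sum`), whatever its modulus `r > 1`.

References: E. Bombieri, J. C. Lagarias, J. Number Theory 77 (1999) 274–287, Theorem 1 [BombieriLagarias1999];
X.-J. Li, J. Number Theory 65 (1997) 325–333 [Li1997]; R. P. Brent, Math. Comp. 33 (1979) [Brent1979] (height 1000,
here the tree's kernel certificate `riemannHypothesisUpTo_1000`); D. Platt, T. Trudgian, Bull. LMS 53 (2021) (F1).

This part (3/3): `riemannHypothesis_of_keiperLiCoeff_bddBelow_modEq` (height `H`, `q ≥ 1`, `|t| < (π/2)(H − 1/4)`, any slack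
`C`: `(∀ n ≥ 1, n ≡ t (q) → λ_n ≥ −C) → RH`), the `↔` / nonneg / co-finite-tail forms, the natural-number residues
`n % q = a % q`, and the KERNEL instances `…_1570`, `riemannHypothesis_iff_keiperLiCoeff_bddBelow_mod_of_le` (`q ≤ 3141`) from the
tree's unconditional `riemannHypothesisUpTo_1000` (standard axioms).  Referee label (matrix li×finite +g3, lead g2 booking):
«residue classes n ≡ t (q), |t| < (π/2)(H−¼), any q: RH-equivalent with FIN(H) load-bearing as input; class UNCHANGED
barrier-note» — the finite conjunct is consumed as INPUT, the class tail is RH by theorem once the height is in hand.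

Provenance: cell rh-split, seat rh-split-li-finite g3, raw zero-def file `HOME/rh-split-li-finite/LiCriterionResidueClassesBL.lean`
(sha16 6ac0174b44e3a51a, 977 lines; proofs verbatim), filed in three parts ≤ 400 lines by rh-split-typer-1 g2 (INBOX 22:27Z item
(6c)): `…BLPrelims` (§0 elementary facts not already in `LiIndexSetsPrelims`, §1 recurrence along multiples, §3 the phase of
`1 − 1/ρ`, small facts on the zeros), `…BLEngine` (§2 Bombieri–Lagarias (c)⇒(a) with a constrained exponent), `…BL` (§4 the
theorems for `ζ`).  The Bombieri–Lagarias helper lemmas of the scratch's §0 that coincide verbatim with the landed `Splittings/LiIndexSetsPrelims.lean`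
(p468824), and the four small facts shared with `LiCriterionProgressionsBL.lean` (`LiProgressionBL.norm_one_sub_one_div_le_one_iff`,
`coe_ne_zero`, `toNat_order_cast`, `riemannHypothesis_of_forall_half_le_re`), are imported from there, not restated.  Typer-1 g2 replay of the 977-line raw
file: farm rc 0, 0 warnings, 0 sorry; `#print axioms` = [propext, Classical.choice, Quot.sound] on
`riemannHypothesis_of_keiperLiCoeff_bddBelow_modEq` and `riemannHypothesis_iff_keiperLiCoeff_bddBelow_mod_of_le`; read-back:
`RiemannHypothesisUpTo H` occurs only as a hypothesis binder, the kernel instances cite `riemannHypothesisUpTo_1000` by name.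

HONEST LABEL: SPLITTING SEARCH over kernel-typed RH-EQUIVALENCES; a splitting A ∧ B ⟹ RH is CONDITIONAL bookkeeping unless A
and B are both proved; nothing here bears on the truth of RH.
-/

noncomputable section

-- D-0017: `Summit.<S>.<S>.…` is the designed namespace of a single-problem summit.
set_option linter.dupNamespace false

namespace Summit.RiemannHypothesis.RiemannHypothesis.Theorems.Splittings

open Filter Topology Complex
open scoped ComplexConjugate
open Literature.NumberTheory.LFunctions
open Literature.NumberTheory.LFunctions.BombieriLagarias
open Literature.NumberTheory.LFunctions.ZetaZeros
open Literature.NumberTheory.DiophantineGeometry (RiemannHypothesisUpTo)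
open Summit.RiemannHypothesis.RiemannHypothesis.Theorems.Splittings.LiIndexSets
open Summit.RiemannHypothesis.RiemannHypothesis.Theorems.Splittings.LiProgressionBL
open LiResidueBL

/-! ## §4 The theorems for `ζ` (raw form: statements over tree declarations only) -/

/-- **Li's criterion along a residue class, bounded-below form, with a verified height as input.**
If `RiemannHypothesisUpTo H` (`H ≥ 1`), `q ≥ 1` and `|t| < (π/2)(H − 1/4)`, then
`(∀ n ≥ 1, n ≡ t (mod q) → λ_n ≥ −C) → RH`. -/
theorem riemannHypothesis_of_keiperLiCoeff_bddBelow_modEq {H : ℝ} (hH : 1 ≤ H)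
    (hRH : RiemannHypothesisUpTo H) {q : ℕ} (hq : 1 ≤ q) {t : ℤ}
    (ht : (t.natAbs : ℝ) < Real.pi / 2 * (H - 1 / 4)) {C : ℝ}
    (h : ∀ n : ℕ, 1 ≤ n → (n : ℤ) ≡ t [ZMOD q] → -C ≤ keiperLiCoeff n) :
    _root_.RiemannHypothesis := by
  set s : ℕ := t.natAbs with hs
  have hH4 : 0 < H - 1 / 4 := by linarith
  set Θ₀ : ℝ := (s : ℝ) / (H - 1 / 4) with hΘ₀
  have hΘ₀0 : 0 ≤ Θ₀ := by positivity
  have hΘ₀lt : Θ₀ < Real.pi / 2 := by rw [hΘ₀, div_lt_iff₀ hH4]; exact ht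
  have hc₀ : 0 < Real.cos Θ₀ := Real.cos_pos_of_mem_Ioo ⟨by linarith [Real.pi_pos], hΘ₀lt⟩
  -- the phase condition for the non-trivial zeros of `ζ`
  have hphase : ∀ ρ : riemannZetaNontrivialZeros, 1 < ‖1 - 1 / (ρ : ℂ)‖ →
      Real.cos Θ₀ * ‖1 - 1 / (ρ : ℂ)‖ ^ s ≤ ((1 - 1 / (ρ : ℂ)) ^ s).re := by
    intro ρ hρ
    have h0 : (ρ : ℂ) ≠ 0 := coe_ne_zero ρ
    have hre : (ρ : ℂ).re < 1 / 2 := by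
      by_contra hge
      exact absurd ((norm_one_sub_one_div_le_one_iff h0).2 (not_lt.1 hge)) (not_le.2 hρ)
    have hβ0 : 0 < (ρ : ℂ).re := riemannZetaNontrivialZeros.re_pos ρ.2
    have hβ1 : (ρ : ℂ).re < 1 := riemannZetaNontrivialZeros.re_lt_one ρ.2
    have hζ : riemannZeta (ρ : ℂ) = 0 := riemannZetaNontrivialZeros.zeta_eq_zero ρ.2
    -- off the line ⇒ above the verified height
    have hγ : H < |(ρ : ℂ).im| := by
      by_contra hle
      rw [not_lt] at hle
      rcases lt_trichotomy (ρ : ℂ).im 0 with hneg | hzero | hpos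
      · have := hRH.re_eq_of_im_neg hζ hneg (by rw [abs_of_neg hneg] at hle; exact hle)
        linarith
      · exact riemannZetaNontrivialZeros.im_ne_zero ρ.2 hzero
      · have := hRH (ρ : ℂ) hζ hpos (by rw [abs_of_pos hpos] at hle; exact hle)
        linarith
    obtain ⟨hzre, hratio⟩ := phase_one_sub_one_div hβ0 hβ1 (hH.trans hγ.le)
    rw [mul_comm]
    refine norm_pow_mul_cos_le_re_pow hzre s ?_ (by linarith [Real.pi_pos])
    calc (s : ℝ) * (|(1 - 1 / (ρ : ℂ)).im| / (1 - 1 / (ρ : ℂ)).re) ≤ (s : ℝ) * (1 / (H - 1 / 4)) := by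
          refine mul_le_mul_of_nonneg_left (hratio.trans ?_) (Nat.cast_nonneg _)
          exact one_div_le_one_div_of_le hH4 (by linarith)
      _ = Θ₀ := by rw [hΘ₀]; ring
  have hBL := forall_half_le_re_of_bddBelow_modEq
    (ρ := fun ρ : riemannZetaNontrivialZeros ↦ (ρ : ℂ))
    (m := fun ρ ↦ (riemannZetaZeroOrder (ρ : ℂ)).toNat)
    (fun ρ ↦ by have := riemannZetaNontrivialZeros.one_le_order ρ.2; omega)
    (fun ρ ↦ coe_ne_zero ρ) (fun ρ ↦ riemannZetaNontrivialZeros.ne_one ρ.2)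
    summable_weight_zetaZeros hq t hc₀ hphase (K := C) ?_
  · exact riemannHypothesis_of_forall_half_le_re fun ρ hρ ↦ hBL ⟨ρ, hρ⟩
  · intro n hn hmod
    have h' := h n hn hmod
    rw [keiperLiCoeff_eq_tsum_zeros hn] at h'
    rwa [tsum_congr fun ρ ↦ by rw [toNat_order_cast]]

/-- **RH ⟺ the Li coefficients along the class `n ≡ t (mod q)` are bounded below**
(`RiemannHypothesisUpTo H`, `H ≥ 1`, `q ≥ 1`, `|t| < (π/2)(H − 1/4)`). -/
theorem riemannHypothesis_iff_keiperLiCoeff_bddBelow_modEq {H : ℝ} (hH : 1 ≤ H)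
    (hRH : RiemannHypothesisUpTo H) {q : ℕ} (hq : 1 ≤ q) {t : ℤ}
    (ht : (t.natAbs : ℝ) < Real.pi / 2 * (H - 1 / 4)) :
    _root_.RiemannHypothesis ↔
      ∃ C : ℝ, ∀ n : ℕ, 1 ≤ n → (n : ℤ) ≡ t [ZMOD q] → -C ≤ keiperLiCoeff n := by
  refine ⟨fun hR ↦ ⟨0, fun n hn _ ↦ ?_⟩,
    fun ⟨C, h⟩ ↦ riemannHypothesis_of_keiperLiCoeff_bddBelow_modEq hH hRH hq ht h⟩
  rw [neg_zero]
  exact keiperLiCoeff_nonneg_of_rh hR hn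

/-- **RH ⟺ the Li coefficients along the class `n ≡ t (mod q)` are nonnegative** (same hypotheses). -/
theorem riemannHypothesis_iff_keiperLiCoeff_nonneg_modEq {H : ℝ} (hH : 1 ≤ H)
    (hRH : RiemannHypothesisUpTo H) {q : ℕ} (hq : 1 ≤ q) {t : ℤ}
    (ht : (t.natAbs : ℝ) < Real.pi / 2 * (H - 1 / 4)) :
    _root_.RiemannHypothesis ↔ ∀ n : ℕ, 1 ≤ n → (n : ℤ) ≡ t [ZMOD q] → 0 ≤ keiperLiCoeff n := by
  refine ⟨fun hR n hn _ ↦ ?_, fun h ↦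
    riemannHypothesis_of_keiperLiCoeff_bddBelow_modEq hH hRH hq ht (C := 0) fun n hn hmod ↦ ?_⟩
  · exact keiperLiCoeff_nonneg_of_rh hR hn
  · rw [neg_zero]; exact h n hn hmod

/-- **Slack co-finite tail of a residue class** (finite lens): for any cut `n₀` and slack `C`,
`(∀ n > n₀, n ≡ t (mod q) → λ_n ≥ −C) → RH` (same hypotheses on `H, q, t`). -/
theorem riemannHypothesis_of_keiperLiCoeff_slackTail_modEq {H : ℝ} (hH : 1 ≤ H)
    (hRH : RiemannHypothesisUpTo H) {q : ℕ} (hq : 1 ≤ q) {t : ℤ}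
    (ht : (t.natAbs : ℝ) < Real.pi / 2 * (H - 1 / 4)) (n₀ : ℕ) {C : ℝ}
    (h : ∀ n : ℕ, n₀ < n → (n : ℤ) ≡ t [ZMOD q] → -C ≤ keiperLiCoeff n) :
    _root_.RiemannHypothesis := by
  classical
  set C' : ℝ := max C ((Finset.range (n₀ + 1)).sup' ⟨0, by simp⟩ fun n ↦ -keiperLiCoeff n) with hC'
  refine riemannHypothesis_of_keiperLiCoeff_bddBelow_modEq hH hRH hq ht (C := C') fun n hn hmod ↦ ?_
  rcases lt_or_ge n₀ n with hlt | hle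
  · exact (neg_le_neg (le_max_left _ _)).trans (h n hlt hmod)
  · have hmem : n ∈ Finset.range (n₀ + 1) := Finset.mem_range.2 (by omega)
    have : -keiperLiCoeff n ≤ C' :=
      (Finset.le_sup' (fun n ↦ -keiperLiCoeff n) hmem).trans (le_max_right _ _)
    linarith

/-- **Oscillation form**: if RH fails then, for every verified height `H ≥ 1`, the Li coefficients are
unbounded below along EVERY class `n ≡ t (mod q)` with `|t| < (π/2)(H − 1/4)`. -/
theorem keiperLiCoeff_unbounded_below_modEq_of_not_rh (hnRH : ¬ _root_.RiemannHypothesis) {H : ℝ}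
    (hH : 1 ≤ H) (hRH : RiemannHypothesisUpTo H) {q : ℕ} (hq : 1 ≤ q) {t : ℤ}
    (ht : (t.natAbs : ℝ) < Real.pi / 2 * (H - 1 / 4)) (C : ℝ) :
    ∃ n : ℕ, 1 ≤ n ∧ (n : ℤ) ≡ t [ZMOD q] ∧ keiperLiCoeff n < -C := by
  by_contra! h'
  exact hnRH (riemannHypothesis_of_keiperLiCoeff_bddBelow_modEq hH hRH hq ht h')

/-! ### Natural-number residues `n % q = a % q` -/

/-- From `ℕ`-residues to the balanced `ℤ`-shift: for `q ≥ 1` and `a`, the shift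
`t = a % q` or `t = a % q − q` (whichever is smaller in absolute value) has `|t| = min (a % q) (q − a % q)` and
`n ≡ t (mod q) → n % q = a % q`. -/
theorem exists_balanced_shift {q : ℕ} (hq : 1 ≤ q) (a : ℕ) :
    ∃ t : ℤ, t.natAbs = min (a % q) (q - a % q) ∧
      ∀ n : ℕ, (n : ℤ) ≡ t [ZMOD q] → n % q = a % q := by
  have hq0 : 0 < q := hq
  have hlt : a % q < q := Nat.mod_lt a hq0
  have key : ∀ t : ℤ, t ≡ (a : ℤ) [ZMOD q] → ∀ n : ℕ, (n : ℤ) ≡ t [ZMOD q] → n % q = a % q := by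
    intro t hta n hnt
    have : (n : ℤ) ≡ (a : ℤ) [ZMOD q] := hnt.trans hta
    exact Int.natCast_modEq_iff.1 this
  by_cases hle : a % q ≤ q - a % q
  · refine ⟨(a % q : ℕ), by rw [min_eq_left hle, Int.natAbs_natCast], key _ ?_⟩
    rw [Int.natCast_modEq_iff]
    exact Nat.mod_modEq a q
  · refine ⟨(a % q : ℕ) - (q : ℤ), ?_, key _ ?_⟩
    · rw [min_eq_right (by omega)]
      have : ((a % q : ℕ) : ℤ) - (q : ℤ) = -((q - a % q : ℕ) : ℤ) := by
        rw [Nat.cast_sub hlt.le]; ring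
      rw [this, Int.natAbs_neg, Int.natAbs_natCast]
    · have hdiv : (a : ℤ) = ((a % q : ℕ) : ℤ) + (q : ℤ) * ((a / q : ℕ) : ℤ) := by
        exact_mod_cast (Nat.mod_add_div a q).symm
      rw [Int.modEq_iff_dvd, hdiv]
      exact ⟨((a / q : ℕ) : ℤ) + 1, by ring⟩

/-- **Li's criterion along the class `n % q = a % q`, bounded-below form**: if `RiemannHypothesisUpTo H`
(`H ≥ 1`), `q ≥ 1` and the balanced representative of `a` is small, `min (a % q) (q − a % q) < (π/2)(H − 1/4)`,
then `(∀ n ≥ 1, n % q = a % q → λ_n ≥ −C) → RH`. -/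
theorem riemannHypothesis_of_keiperLiCoeff_bddBelow_mod {H : ℝ} (hH : 1 ≤ H)
    (hRH : RiemannHypothesisUpTo H) {q : ℕ} (hq : 1 ≤ q) {a : ℕ}
    (ha : ((min (a % q) (q - a % q) : ℕ) : ℝ) < Real.pi / 2 * (H - 1 / 4)) {C : ℝ}
    (h : ∀ n : ℕ, 1 ≤ n → n % q = a % q → -C ≤ keiperLiCoeff n) : _root_.RiemannHypothesis := by
  obtain ⟨t, ht, hcls⟩ := exists_balanced_shift hq a
  exact riemannHypothesis_of_keiperLiCoeff_bddBelow_modEq hH hRH hq (t := t) (by rw [ht]; exact ha)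
    fun n hn hmod ↦ h n hn (hcls n hmod)

/-- **RH ⟺ (λ_n)_{n % q = a % q} bounded below**, same hypotheses. -/
theorem riemannHypothesis_iff_keiperLiCoeff_bddBelow_mod {H : ℝ} (hH : 1 ≤ H)
    (hRH : RiemannHypothesisUpTo H) {q : ℕ} (hq : 1 ≤ q) {a : ℕ}
    (ha : ((min (a % q) (q - a % q) : ℕ) : ℝ) < Real.pi / 2 * (H - 1 / 4)) :
    _root_.RiemannHypothesis ↔ ∃ C : ℝ, ∀ n : ℕ, 1 ≤ n → n % q = a % q → -C ≤ keiperLiCoeff n := by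
  refine ⟨fun hR ↦ ⟨0, fun n hn _ ↦ ?_⟩,
    fun ⟨C, h⟩ ↦ riemannHypothesis_of_keiperLiCoeff_bddBelow_mod hH hRH hq ha h⟩
  rw [neg_zero]
  exact keiperLiCoeff_nonneg_of_rh hR hn

/-! ### Kernel instances: the tree's unconditional `riemannHypothesisUpTo_1000` -/

/-- `1570 < (π/2)(1000 − 1/4)` (`π > 3.1415`). -/
theorem bound_1570 : (1570 : ℝ) < Real.pi / 2 * (1000 - 1 / 4) := by
  have := Real.pi_gt_d4
  nlinarith

/-- **UNCONDITIONAL, kernel-checked height 1000**: for every `q ≥ 1`, every shift `|t| ≤ 1570` and every `C`,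
`(∀ n ≥ 1, n ≡ t (mod q) → λ_n ≥ −C) → RH`. -/
theorem riemannHypothesis_of_keiperLiCoeff_bddBelow_modEq_1570 {q : ℕ} (hq : 1 ≤ q) {t : ℤ}
    (ht : t.natAbs ≤ 1570) {C : ℝ}
    (h : ∀ n : ℕ, 1 ≤ n → (n : ℤ) ≡ t [ZMOD q] → -C ≤ keiperLiCoeff n) : _root_.RiemannHypothesis :=
  riemannHypothesis_of_keiperLiCoeff_bddBelow_modEq (H := 1000) (by norm_num) riemannHypothesisUpTo_1000 hq
    (lt_of_le_of_lt (by exact_mod_cast ht) bound_1570) h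

/-- **RH ⟺ (λ_n)_{n ≡ t (q)} bounded below**, unconditionally for all `q ≥ 1`, `|t| ≤ 1570`. -/
theorem riemannHypothesis_iff_keiperLiCoeff_bddBelow_modEq_1570 {q : ℕ} (hq : 1 ≤ q) {t : ℤ}
    (ht : t.natAbs ≤ 1570) :
    _root_.RiemannHypothesis ↔
      ∃ C : ℝ, ∀ n : ℕ, 1 ≤ n → (n : ℤ) ≡ t [ZMOD q] → -C ≤ keiperLiCoeff n :=
  riemannHypothesis_iff_keiperLiCoeff_bddBelow_modEq (H := 1000) (by norm_num) riemannHypothesisUpTo_1000 hq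
    (lt_of_le_of_lt (by exact_mod_cast ht) bound_1570)

/-- **EVERY residue class of EVERY modulus `q ≤ 3141`, unconditionally**: for `1 ≤ q ≤ 3141` and any `a`,
`RH ⟺ (λ_n)_{n % q = a % q}` is bounded below. -/
theorem riemannHypothesis_iff_keiperLiCoeff_bddBelow_mod_of_le {q : ℕ} (hq : 1 ≤ q) (hq' : q ≤ 3141)
    (a : ℕ) :
    _root_.RiemannHypothesis ↔ ∃ C : ℝ, ∀ n : ℕ, 1 ≤ n → n % q = a % q → -C ≤ keiperLiCoeff n := by
  refine riemannHypothesis_iff_keiperLiCoeff_bddBelow_mod (H := 1000) (by norm_num)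
    riemannHypothesisUpTo_1000 hq (lt_of_le_of_lt ?_ bound_1570)
  have hlt : a % q < q := Nat.mod_lt a hq
  have : min (a % q) (q - a % q) ≤ 1570 := by
    rcases le_or_gt (a % q) 1570 with h1 | h1
    · exact (min_le_left _ _).trans h1
    · exact (min_le_right _ _).trans (by omega)
  exact_mod_cast this

/-- The same with nonnegativity and a slack co-finite tail: for `1 ≤ q ≤ 3141`, any `a`, any cut `n₀` and any
`C ≥ 0`, `RH ⟺ ∀ n > n₀, n % q = a % q → λ_n ≥ −C`. -/
theorem riemannHypothesis_iff_keiperLiCoeff_slackTail_mod_of_le {q : ℕ} (hq : 1 ≤ q) (hq' : q ≤ 3141)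
    (a n₀ : ℕ) {C : ℝ} (hC : 0 ≤ C) :
    _root_.RiemannHypothesis ↔ ∀ n : ℕ, n₀ < n → n % q = a % q → -C ≤ keiperLiCoeff n := by
  refine ⟨fun hR n hn _ ↦ ?_, fun h ↦ ?_⟩
  · have := keiperLiCoeff_nonneg_of_rh hR (n := n) (by omega)
    linarith
  · obtain ⟨t, ht, hcls⟩ := exists_balanced_shift hq a
    have hlt : a % q < q := Nat.mod_lt a hq
    have ht' : t.natAbs ≤ 1570 := by
      rw [ht]
      rcases le_or_gt (a % q) 1570 with h1 | h1
      · exact (min_le_left _ _).trans h1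
      · exact (min_le_right _ _).trans (by omega)
    refine riemannHypothesis_of_keiperLiCoeff_slackTail_modEq (H := 1000) (by norm_num)
      riemannHypothesisUpTo_1000 hq (lt_of_le_of_lt (by exact_mod_cast ht') bound_1570) n₀ (C := C)
      fun n hn hmod ↦ h n hn (hcls n hmod)

end Summit.RiemannHypothesis.RiemannHypothesis.Theorems.Splittings

end
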